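import Literature.AnabelianGeometry.AbsoluteAnabelian.MLFGaloisGroups
import Literature.AnabelianGeometry.AbsoluteAnabelian.GaloisSubextensionProofs
import Literature.AnabelianGeometry.AbsoluteAnabelian.AbsTopIII.KummerFaithfulPadicProofs
import Literature.AnabelianGeometry.AbsoluteAnabelian.AbsTopIII.PadicEmbeddingRigidity
import Mathlib.FieldTheory.Galois.Infinite
import HarnessLib

/-!
# [AbsAnab] Thm 1.1.1 (ii), local half — `G_K` is slim for an MLF `K`: an UNCONDITIONAL proof
# (Kummer theory; no local class field theory)

S. Mochizuki, *The Absolute Anabelian Geometry of Hyperbolic Curves* (2004) [AbsAnab], Thm 1.1.1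
(ii) p. 6 (manuscript pagination, lit key paper:url-e8f118cc205e), the form [IUTchI] cites
("`G_v` is slim [AbsAnab, Theorem 1.1.1, (ii)]"): the absolute Galois group of a finite extension
`K` of `ℚ_p` is slim — every `σ ∈ G_K` centralising an open subgroup is trivial.  The tree types
it as the named fact `galoisMLF_slim` (`MLFGaloisGroups.lean`, abc-iut-L4-t4); the printed
deduction "from local class field theory" is kernel-checked CONDITIONALLY in `MLFSlimProofs.lean`
(abc-iut-L4-t11, `galoisMLF_slim_of_reciprocity`).  THIS file proves `galoisMLF_slim` OUTRIGHT
(`galoisMLF_slim_holds`), by a reciprocity-free argument: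

Let `σ` centralise the open subgroup `U = Gal(K̄/E₀)` and let `x ∈ K̄`; put `M := E₀(x)·` (a
finite extension of `K` inside `K̄` containing `E₀` and `x`), so `σ` commutes with `Gal(K̄/M)`.
1. KUMMER (`exists_int_forall_sigma_eq`): for `n ≥ 1` let `σ ζ = ζ^m` on `μ_n(K̄)`
   (Mathlib `rootsOfUnity.integer_power_of_ringEquiv`).  For `a ∈ M^×` and `αⁿ = a`, every
   `τ ∈ Gal(K̄/M)` moves `α` by an `n`-th root of unity and commutes with `σ`, so
   `β := σ(α)/α^m` is `Gal(K̄/M)`-fixed, i.e. `β ∈ M` (infinite Galois correspondence), and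
   `σ(a) = βⁿ · a^m`.
2. VALUATION (`exists_uniformizer`): with the spectral norm `‖·‖` on `K̄ ⊇ M ⊇ ℚ_p`,
   `‖z‖^{[M:ℚ_p]!} = p^{e(z)}`, `e(z) ∈ ℤ`, for `z ∈ M^×` (`PadicEmbeddingRigidity`); pick `π ∈ M^×`
   with minimal positive exponent `g`; then `g ∣ e(z)` for all `z ∈ M^×`.  Since `‖σ π‖ = ‖π‖`
   (Mathlib `spectralNorm_eq_of_equiv`), step 1 for `a = π` gives `g = n·e(β) + m·g`, whence
   `m ≡ 1 (mod n)`.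
3. Hence `σ(x)/x ∈ (M^×)ⁿ` for every `n`, so `σ(x)/x = 1` by `⋂_n (M^×)ⁿ = {1}` for the finite
   extension `M/ℚ_p` (`divisibleElementsTrivial_units_of_finite_padic`,
   `KummerFaithfulPadicProofs`).
Thus `σ` fixes `K̄` pointwise, `σ = 1`.

Proof-only: no definitions.  HONEST FRAMING: a classical theorem (slimness of `G_K`, `K` a
`p`-adic field) with a proof that uses neither the reciprocity map nor any other unformalised
input; nothing here bears on [IUTchIII] Cor. 3.12. [cite: MochizukiAbsAnab2004, Thm 1.1.1 (ii) p.6]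
-/

noncomputable section

open scoped Classical

namespace Literature.AnabelianGeometry.AbsoluteAnabelian

open Field IntermediateField
open Literature.AlgebraicGeometry.Frobenioids (IsSlimGroup)
open AbsTopIII

/-! ## Step 1: the Kummer computation -/

section Kummer

variable {K : Type} [Field K] [CharZero K]

/-- KUMMER STEP.  Let `M ⊆ K̄` be a subextension of `K` and `σ ∈ Gal(K̄/K)` commute with every
element of `Gal(K̄/M)`.  For `n ≥ 1` there is an integer `m` (the exponent by which `σ` acts on
`μ_n(K̄)`) such that every nonzero `a ∈ M` satisfies `σ(a) = βⁿ · a^m` for some nonzero `β ∈ M`.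
[cite: MochizukiAbsAnab2004, Thm 1.1.1 (ii) p.6] -/
theorem exists_int_forall_sigma_eq (M : IntermediateField K (AlgebraicClosure K))
    (σ : AlgebraicClosure K ≃ₐ[K] AlgebraicClosure K)
    (hσ : ∀ τ ∈ M.fixingSubgroup, ∀ y : AlgebraicClosure K, τ (σ y) = σ (τ y))
    {n : ℕ} (hn : 0 < n) :
    ∃ m : ℤ, ∀ a : AlgebraicClosure K, a ∈ M → a ≠ 0 →
      ∃ β : AlgebraicClosure K, β ∈ M ∧ β ≠ 0 ∧ σ a = β ^ n * a ^ m := by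
  haveI : NeZero n := ⟨hn.ne'⟩
  -- `σ` acts on `μ_n(K̄)` by `ζ ↦ ζ^m`
  obtain ⟨m, hm⟩ := rootsOfUnity.integer_power_of_ringEquiv n (σ : AlgebraicClosure K ≃+* _)
  refine ⟨m, fun a haM ha0 => ?_⟩
  -- an `n`-th root `α` of `a`
  obtain ⟨α, hα⟩ := IsAlgClosed.exists_pow_nat_eq a hn
  have hα0 : α ≠ 0 := by
    rintro rfl
    rw [zero_pow hn.ne'] at hα
    exact ha0 hα.symm
  set β : AlgebraicClosure K := σ α / α ^ m with hβdef
  have hβ0 : β ≠ 0 := by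
    rw [hβdef]
    exact div_ne_zero ((map_ne_zero σ).mpr hα0) (zpow_ne_zero _ hα0)
  -- `β` is fixed by `Gal(K̄/M)`
  have hβM : β ∈ M := by
    rw [← InfiniteGalois.fixedField_fixingSubgroup M, IntermediateField.mem_fixedField_iff]
    intro τ hτ
    -- `τ α = ζ α` with `ζ` an `n`-th root of unity
    have hτa : τ a = a := (IntermediateField.mem_fixingSubgroup_iff _ _).mp hτ a haM
    have hζn : (τ α / α) ^ n = 1 := by
      rw [div_pow, ← map_pow, hα, hτa, div_self ha0]
    have hζ0 : τ α / α ≠ 0 := div_ne_zero ((map_ne_zero τ).mpr hα0) hα0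
    set ζu : (AlgebraicClosure K)ˣ := Units.mk0 (τ α / α) hζ0 with hζu
    have hζmem : ζu ∈ rootsOfUnity n (AlgebraicClosure K) := by
      rw [mem_rootsOfUnity]
      exact Units.ext (by simp [hζu, hζn])
    have hσζ : σ (τ α / α) = (τ α / α) ^ m := by
      have := hm ⟨ζu, hζmem⟩
      -- `this : σ ↑ζu = ↑(ζu ^ m)` as elements of `K̄`
      simpa [hζu, Units.val_zpow_eq_zpow_val] using this
    have hτα : τ α = (τ α / α) * α := by rw [div_mul_cancel₀ _ hα0]
    -- compute `τ β`
    rw [hβdef, map_div₀, map_zpow₀, hσ τ hτ α, hτα, map_mul, hσζ, mul_zpow]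
    field_simp
  refine ⟨β, hβM, hβ0, ?_⟩
  -- `σ a = σ (α^n) = (β α^m)^n = β^n a^m`
  have hσα : σ α = β * α ^ m := by rw [hβdef, div_mul_cancel₀ _ (zpow_ne_zero _ hα0)]
  calc σ a = σ (α ^ n) := by rw [hα]
    _ = (β * α ^ m) ^ n := by rw [map_pow, hσα]
    _ = β ^ n * (α ^ n) ^ m := by rw [mul_pow, ← zpow_natCast (α ^ m), ← zpow_mul, mul_comm m,
        zpow_mul, zpow_natCast]
    _ = β ^ n * a ^ m := by rw [hα]

end Kummer

/-! ## Step 2: the spectral exponent on a finite subextension -/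

section Valuation

variable {p : ℕ} [Fact p.Prime] {K : Type} [Field K] [Algebra ℚ_[p] K] [FiniteDimensional ℚ_[p] K]

/-- EXPONENTS.  For a finite subextension `M ⊆ K̄` of `K` (an MLF over `ℚ_p`) and
`D := [M:ℚ_p]!`, every nonzero `z ∈ M` has `‖z‖^D = p^e` for a (unique) integer `e`, `‖·‖` the
spectral norm of `K̄/ℚ_p`. [cite: MochizukiAbsAnab2004, Thm 1.1.1 (ii) p.6] -/
private theorem exists_exponent (M : IntermediateField K (AlgebraicClosure K))
    [FiniteDimensional K M] {z : AlgebraicClosure K} (hzM : z ∈ M) (hz0 : z ≠ 0) :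
    ∃ e : ℤ, spectralNorm ℚ_[p] (AlgebraicClosure K) z ^
      (Module.finrank ℚ_[p] M).factorial = (p : ℝ) ^ e := by
  haveI : IsScalarTower ℚ_[p] M (AlgebraicClosure K) := IsScalarTower.of_algebraMap_eq fun _ => rfl
  haveI : FiniteDimensional ℚ_[p] M := Module.Finite.trans K M
  have hz0' : (⟨z, hzM⟩ : M) ≠ 0 := fun h => hz0 (congrArg Subtype.val h)
  obtain ⟨e, he⟩ := exists_spectralNorm_pow_factorial_eq_zpow p M ⟨z, hzM⟩ hz0'
  refine ⟨e, ?_⟩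
  rw [← he, spectralNorm.eq_of_tower (K := ℚ_[p]) (L := AlgebraicClosure K) (⟨z, hzM⟩ : M)]
  rfl

/-- A "uniformizer" for the spectral exponent: a nonzero `π ∈ M` whose exponent `g > 0` divides
the exponent of every nonzero element of `M`. [cite: MochizukiAbsAnab2004, Thm 1.1.1 (ii) p.6] -/
private theorem exists_uniformizer (M : IntermediateField K (AlgebraicClosure K))
    [FiniteDimensional K M] :
    ∃ (π : AlgebraicClosure K) (g : ℤ), π ∈ M ∧ π ≠ 0 ∧ 0 < g ∧
      spectralNorm ℚ_[p] (AlgebraicClosure K) π ^ (Module.finrank ℚ_[p] M).factorial =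
        (p : ℝ) ^ g ∧
      ∀ (z : AlgebraicClosure K) (e : ℤ), z ∈ M → z ≠ 0 →
        spectralNorm ℚ_[p] (AlgebraicClosure K) z ^ (Module.finrank ℚ_[p] M).factorial =
          (p : ℝ) ^ e → g ∣ e := by
  haveI : CharZero K := charZero_of_injective_algebraMap (algebraMap ℚ_[p] K).injective
  set D := (Module.finrank ℚ_[p] M).factorial with hD
  have hp : p.Prime := Fact.out
  have hp1 : (1 : ℝ) < p := by exact_mod_cast hp.one_lt
  have hp0 : (0 : ℝ) < p := lt_trans zero_lt_one hp1
  haveI : Algebra.IsAlgebraic K (AlgebraicClosure K) := AlgebraicClosure.isAlgebraic K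
  haveI : Algebra.IsAlgebraic ℚ_[p] K := Algebra.IsAlgebraic.of_finite ℚ_[p] K
  haveI : Algebra.IsAlgebraic ℚ_[p] (AlgebraicClosure K) :=
    Algebra.IsAlgebraic.trans ℚ_[p] K (AlgebraicClosure K)
  -- uniqueness of exponents
  have huniq : ∀ {z : AlgebraicClosure K} {e e' : ℤ},
      spectralNorm ℚ_[p] (AlgebraicClosure K) z ^ D = (p : ℝ) ^ e →
      spectralNorm ℚ_[p] (AlgebraicClosure K) z ^ D = (p : ℝ) ^ e' → e = e' := by
    intro z e e' h h'
    exact zpow_right_injective₀ hp0 hp1.ne' (h.symm.trans h')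
  -- the set of positive exponents is nonempty: `z = p⁻¹` has exponent `D > 0`
  have hDpos : 0 < D := Nat.factorial_pos _
  have hpO : (p : AlgebraicClosure K) ≠ 0 := by
    haveI : CharZero (AlgebraicClosure K) :=
      charZero_of_injective_algebraMap (algebraMap K (AlgebraicClosure K)).injective
    exact_mod_cast hp.ne_zero
  have hpinvM : (p : AlgebraicClosure K)⁻¹ ∈ M := inv_mem (_root_.natCast_mem M p)
  have hpinv : spectralNorm ℚ_[p] (AlgebraicClosure K) ((p : AlgebraicClosure K)⁻¹) ^ D =
      (p : ℝ) ^ (D : ℤ) := by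
    letI : NormedField (AlgebraicClosure K) := spectralNorm.normedField ℚ_[p] (AlgebraicClosure K)
    have hnorm : ∀ z : AlgebraicClosure K, ‖z‖ = spectralNorm ℚ_[p] (AlgebraicClosure K) z :=
      fun _ => rfl
    rw [← hnorm, norm_inv, hnorm, ← map_natCast (algebraMap ℚ_[p] (AlgebraicClosure K)) p,
      spectralNorm_extends, Padic.norm_p, inv_inv, zpow_natCast]
  let S : Set ℕ := {k | 0 < k ∧ ∃ z : AlgebraicClosure K, z ∈ M ∧ z ≠ 0 ∧
    spectralNorm ℚ_[p] (AlgebraicClosure K) z ^ D = (p : ℝ) ^ (k : ℤ)}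
  have hSne : S.Nonempty := ⟨D, hDpos, (p : AlgebraicClosure K)⁻¹, hpinvM, inv_ne_zero hpO, hpinv⟩
  -- minimal positive exponent
  set g : ℕ := Nat.find hSne with hgdef
  have hgS : g ∈ S := Nat.find_spec hSne
  have hgmin : ∀ k ∈ S, g ≤ k := fun k hk => Nat.find_min' hSne hk
  obtain ⟨hgpos, π, hπM, hπ0, hπ⟩ := hgS
  refine ⟨π, g, hπM, hπ0, by exact_mod_cast hgpos, hπ, fun z e hzM hz0 hz => ?_⟩
  -- division with remainder: `e = q g + r`
  obtain ⟨q, r, hr0, hrg, he⟩ : ∃ q r : ℤ, 0 ≤ r ∧ r < g ∧ e = q * g + r := by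
    refine ⟨e / g, e % g, Int.emod_nonneg _ (by exact_mod_cast hgpos.ne'),
      Int.emod_lt_of_pos _ (by exact_mod_cast hgpos), ?_⟩
    have := Int.mul_ediv_add_emod e (g : ℤ)  -- `g * (e / g) + e % g = e`
    linarith
  -- the element `z * π^(-q)` has exponent `r`
  have hw : spectralNorm ℚ_[p] (AlgebraicClosure K) (z * π ^ (-q)) ^ D = (p : ℝ) ^ r := by
    letI : NormedField (AlgebraicClosure K) := spectralNorm.normedField ℚ_[p] (AlgebraicClosure K)
    have hnorm : ∀ z : AlgebraicClosure K, ‖z‖ = spectralNorm ℚ_[p] (AlgebraicClosure K) z :=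
      fun _ => rfl
    simp only [← hnorm] at hz hπ ⊢
    rw [norm_mul, norm_zpow, mul_pow, ← zpow_natCast (‖π‖ ^ (-q)), ← zpow_mul, mul_comm (-q),
      zpow_mul, zpow_natCast, hz, hπ, ← zpow_mul, ← zpow_add₀ hp0.ne']
    congr 1
    rw [he]
    ring
  by_contra hndvd
  have hrpos : 0 < r := by
    rcases hr0.lt_or_eq with h | h
    · exact h
    · exfalso
      exact hndvd ⟨q, by rw [he, ← h, add_zero, mul_comm]⟩
  -- then `r.toNat ∈ S`, contradicting minimality
  have hrS : r.toNat ∈ S := by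
    refine ⟨by omega, z * π ^ (-q), mul_mem hzM (zpow_mem hπM _),
      mul_ne_zero hz0 (zpow_ne_zero _ hπ0), ?_⟩
    rw [Int.toNat_of_nonneg hr0]
    exact hw
  have := hgmin _ hrS
  omega

end Valuation

/-! ## Step 3: assembly -/

/-- **[AbsAnab] Thm 1.1.1 (ii), local half — DISCHARGED unconditionally**: the absolute Galois
group of a finite extension `K` of `ℚ_p` is slim ("`G_v` is slim").  Proof by Kummer theory and
the triviality of infinitely divisible elements of `M^×` for finite `M/ℚ_p` — no local class
field theory. [cite: MochizukiAbsAnab2004, Thm 1.1.1 (ii) p.6] -/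
theorem galoisMLF_slim_holds : galoisMLF_slim := by
  intro p _ K _ _ _
  haveI : CharZero K := charZero_of_injective_algebraMap (algebraMap ℚ_[p] K).injective
  have hp : p.Prime := Fact.out
  have hp1 : (1 : ℝ) < p := by exact_mod_cast hp.one_lt
  have hp0 : (0 : ℝ) < p := lt_trans zero_lt_one hp1
  haveI : Algebra.IsAlgebraic K (AlgebraicClosure K) := AlgebraicClosure.isAlgebraic K
  haveI : Algebra.IsAlgebraic ℚ_[p] K := Algebra.IsAlgebraic.of_finite ℚ_[p] K
  haveI : Algebra.IsAlgebraic ℚ_[p] (AlgebraicClosure K) :=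
    Algebra.IsAlgebraic.trans ℚ_[p] K (AlgebraicClosure K)
  refine ⟨fun U hU => ?_⟩
  rw [eq_bot_iff]
  intro σ hσ
  rw [Subgroup.mem_centralizer_iff] at hσ
  rw [Subgroup.mem_bot]
  set σ' : (AlgebraicClosure K) ≃ₐ[K] (AlgebraicClosure K) :=
    absoluteGaloisGroup.toAlgEquiv K σ with hσ'
  -- it suffices that `σ` fixes every `x ∈ K̄`
  suffices hfix : ∀ x : (AlgebraicClosure K), σ' x = x by
    apply (absoluteGaloisGroup.toAlgEquiv K).injective
    rw [map_one]
    exact AlgEquiv.ext hfix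
  -- `U = Gal(K̄/E₀)` for a finite subextension `E₀`
  obtain ⟨E₀, hE₀fin, -, hE₀U⟩ := exists_intermediateField_of_isOpen_absoluteGaloisGroup K U hU
  haveI := hE₀fin
  intro x
  by_cases hx0 : x = 0
  · rw [hx0, map_zero]
  -- `M := E₀ ⊔ K(x)`, finite over `K`, contains `x`; `Gal(K̄/M) ≤ U` commutes with `σ`
  haveI : FiniteDimensional K K⟮x⟯ :=
    IntermediateField.adjoin.finiteDimensional (Algebra.IsIntegral.isIntegral x)
  set M : IntermediateField K (AlgebraicClosure K) := E₀ ⊔ K⟮x⟯ with hMdef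
  haveI : FiniteDimensional K M := IntermediateField.finiteDimensional_sup E₀ K⟮x⟯
  have hxM : x ∈ M := (le_sup_right : K⟮x⟯ ≤ M) (IntermediateField.mem_adjoin_simple_self K x)
  have hcomm : ∀ τ ∈ M.fixingSubgroup, ∀ y : (AlgebraicClosure K), τ (σ' y) = σ' (τ y) := by
    intro τ hτ y
    have hτE₀ : τ ∈ E₀.fixingSubgroup := by
      rw [IntermediateField.mem_fixingSubgroup_iff] at hτ ⊢
      exact fun z hz => hτ z ((le_sup_left : E₀ ≤ M) hz)
    have hτU : (absoluteGaloisGroup.toAlgEquiv K).symm τ ∈ U := by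
      rw [← hE₀U]
      exact hτE₀
    have h := hσ _ hτU
    -- `h : τ * σ = σ * τ` in `G_K`; apply to `y`
    have h' := congrArg (fun g => absoluteGaloisGroup.toAlgEquiv K g y) h
    simpa [hσ', AlgEquiv.mul_apply] using h'
  -- `σ x ∈ M`
  have hσxM : σ' x ∈ M := by
    rw [← InfiniteGalois.fixedField_fixingSubgroup M, IntermediateField.mem_fixedField_iff]
    intro τ hτ
    rw [hcomm τ hτ x, (IntermediateField.mem_fixingSubgroup_iff _ _).mp hτ x hxM]
  -- the unit `u := σ x / x` of `M` is infinitely divisible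
  haveI : IsScalarTower ℚ_[p] M (AlgebraicClosure K) := IsScalarTower.of_algebraMap_eq fun _ => rfl
  haveI : FiniteDimensional ℚ_[p] M := Module.Finite.trans K M
  have hσx0 : σ' x ≠ 0 := (map_ne_zero σ').mpr hx0
  set xM : M := ⟨x, hxM⟩ with hxMdef
  set sxM : M := ⟨σ' x, hσxM⟩ with hsxMdef
  have hxM0 : xM ≠ 0 := fun h => hx0 (congrArg Subtype.val h)
  have hsxM0 : sxM ≠ 0 := fun h => hσx0 (congrArg Subtype.val h)
  set u : Mˣ := Units.mk0 sxM hsxM0 / Units.mk0 xM hxM0 with hudef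
  -- for every `n ≥ 1`, `u` is an `n`-th power in `Mˣ`
  have hdiv : ∀ n : ℕ, 0 < n → ∃ b : Mˣ, b ^ n = u := by
    intro n hn
    obtain ⟨m, hm⟩ := exists_int_forall_sigma_eq M σ' hcomm hn
    -- Step 2: `m ≡ 1 (mod n)` via the uniformizer `π`
    obtain ⟨π, g, hπM, hπ0, hgpos, hπ, hgdvd⟩ := exists_uniformizer (p := p) M
    obtain ⟨βπ, hβπM, hβπ0, hσπ⟩ := hm π hπM hπ0
    obtain ⟨eβ, heβ⟩ := exists_exponent (p := p) M hβπM hβπ0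
    obtain ⟨t, ht⟩ := hgdvd βπ eβ hβπM hβπ0 heβ
    have hσπM : σ' π ∈ M := by
      rw [hσπ]; exact mul_mem (pow_mem hβπM n) (zpow_mem hπM m)
    -- norms: `‖σ π‖ = ‖π‖`
    have hm1 : ∃ s : ℤ, m = 1 - n * s := by
      letI : NormedField (AlgebraicClosure K) := spectralNorm.normedField ℚ_[p] (AlgebraicClosure K)
      have hnorm : ∀ z : AlgebraicClosure K, ‖z‖ = spectralNorm ℚ_[p] (AlgebraicClosure K) z :=
      fun _ => rfl
      have hinv : ‖σ' π‖ = ‖π‖ := by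
        rw [hnorm, hnorm]
        exact (spectralNorm_eq_of_equiv (σ'.restrictScalars ℚ_[p]) π).symm
      have hD : ‖σ' π‖ ^ (Module.finrank ℚ_[p] M).factorial =
          ((p : ℝ) ^ eβ) ^ n * ((p : ℝ) ^ g) ^ m := by
        rw [hσπ, norm_mul, norm_pow, norm_zpow, mul_pow, ← pow_mul, mul_comm n, pow_mul,
          hnorm βπ, heβ, ← zpow_natCast (‖π‖ ^ m), ← zpow_mul, mul_comm m, zpow_mul,
          zpow_natCast, hnorm π, hπ]
      rw [hinv, hnorm π, hπ, ← zpow_natCast, ← zpow_mul, ← zpow_mul, ← zpow_add₀ hp0.ne'] at hD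
      have hexp : g = eβ * n + g * m := zpow_right_injective₀ hp0 hp1.ne' hD
      rw [ht] at hexp
      refine ⟨t, ?_⟩
      have hg0 : g ≠ 0 := hgpos.ne'
      have : g * (1 - (m + n * t)) = 0 := by linarith
      rcases mul_eq_zero.mp this with h | h
      · exact absurd h hg0
      · linarith
    obtain ⟨s, hs⟩ := hm1
    -- Step 1 for `a = x`: `σ x = β^n x^m = (β x^{-s})^n x`
    obtain ⟨β, hβM, hβ0, hσxeq⟩ := hm x hxM hx0
    have hb0 : (⟨β * x ^ (-s), mul_mem hβM (zpow_mem hxM _)⟩ : M) ≠ 0 := by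
      intro h
      have := congrArg Subtype.val h
      exact mul_ne_zero hβ0 (zpow_ne_zero _ hx0) this
    refine ⟨Units.mk0 _ hb0, ?_⟩
    apply Units.ext
    apply Subtype.ext
    -- both sides as elements of `(AlgebraicClosure K)`
    change (β * x ^ (-s)) ^ n = σ' x / x
    rw [hσxeq, hs, eq_div_iff hx0, mul_pow, ← zpow_natCast (x ^ (-s)), ← zpow_mul]
    rw [show x ^ (1 - (n : ℤ) * s) = x * x ^ (-(n : ℤ) * s) by
      rw [← zpow_one_add₀ hx0]; ring_nf]
    ring
  -- conclude with the triviality of infinitely divisible units of `M`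
  have hu1 : u = 1 :=
    (divisibleElementsTrivial_units_of_finite_padic p M).eq_one_of_forall_exists_pow u hdiv
  have := congrArg (fun v : Mˣ => ((v : M) : (AlgebraicClosure K))) hu1
  simp only [hudef, Units.val_div_eq_div_val, Units.val_mk0, Units.val_one] at this
  have hval : ((sxM / xM : M) : (AlgebraicClosure K)) = σ' x / x := rfl
  rw [hval] at this
  simpa [div_eq_one_iff_eq hx0] using this

end Literature.AnabelianGeometry.AbsoluteAnabelian
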